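import Mathlib
import HarnessLib.Audit
import Summits.PneNP.PneNP.Theorems.PstarGateU2Touch
import Summits.PneNP.PneNP.Theorems.PstarGateCaseT

/-!
# One GATED chord, CASE T: every edge of the gated cycle off `u` touches every other cycle, and conversely (E2; prover-1 g19)

FRONTIER range-avoidance ladder, rung F-N3 (`stmt-PneNP-19007`), cell `pnp-ideate` (`PstarGateNodesX`, nodes N3/N4); restricted-model proof
complexity — nothing here bears on `P` versus `NP`.

In CASE T (the other chords read along one transverse direction `mv ∈ {(0,1),(1,1)}` and are read) the chamber incompatibility
`PstarGateCaseT.caseT_not_cokillable` (`Z(u_e) ∩ Z(u_{e'}) ∩ H₁ = ∅`) is exactly the forcing hypothesis of the four-point lemma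
`PstarGateU2Touch.touch_core`, in both directions:

* `caseT_touch` — every edge of `D e` with both AND variables off `u` has an AND variable among those of `D e'`, for every other chord `e'`;
* `caseT_touch'` — every edge of `D e'` with both AND variables off `u` has an AND variable among those of `D e`.
-/

set_option linter.dupNamespace false -- `Summit.PneNP.PneNP.…`: summit = sub-problem name (D-0017 single-conjunct layout)

open Finset Literature.Computability.Complexity
open Summit.PneNP.PneNP.Theorems.PstarTyped (Typed)
open Summit.PneNP.PneNP.Theorems.PstarSALevel (SimpleOverlap)
open Summit.PneNP.PneNP.Theorems.PstarGapLinearised (andPair)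
open Summit.PneNP.PneNP.Theorems.PstarReadSumset (V2)
open Summit.PneNP.PneNP.Theorems.PstarChordSystem (ChordSystem)
open Summit.PneNP.PneNP.Theorems.PstarChordBridgeTools (privs coef)
open Summit.PneNP.PneNP.Theorems.PstarChordBridge (BridgeData sys Solution Lift)
open Summit.PneNP.PneNP.Theorems.PstarGateBridge (GateHyp)
open Summit.PneNP.PneNP.Theorems.PstarGateCaseT (caseT_not_cokillable)
open Summit.PneNP.PneNP.Theorems.PstarGateNodes (GateData)
open Summit.PneNP.PneNP.Theorems.PstarGateNodesX (GateDataX)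
open Summit.PneNP.PneNP.Theorems.PstarGateU2Touch (touch_core)

namespace Summit.PneNP.PneNP.Theorems.PstarGateCaseTTouch

variable {n m : ℕ}

/-- **CASE T separation on the gate chamber, as a forcing**: `u_e = 0 ⟹ u_{e'} = 1` where `x_u = κ₀ + 1`. -/
theorem caseT_force (I : LocalMap 4 n m) (hI : I.IsPure xorAndPred) (hT : Typed I) {r₀ : ℕ} {B : BridgeData n m} {e g₀ : Fin m} {u : Fin n}
    {κ₀ : ZMod 2} (hD : GateDataX I r₀ B e g₀ u κ₀) {mv : V2} (hmvT : mv = (0, 1) ∨ mv = (1, 1)) {e' : Fin m} (he' : e' ∈ B.N) (hne : e' ≠ e)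
    (hP : ∀ a, ((sys I B).ρ e' a = 0 ∨ (sys I B).ρ e' a = mv) ∧ ((sys I B).ρ' e' a = 0 ∨ (sys I B).ρ' e' a = mv))
    (hread : ∀ a, (sys I B).ρ e' a ≠ 0 ∨ (sys I B).ρ' e' a ≠ 0) :
    ∀ x : Fin n → ZMod 2, x u = κ₀ + 1 → (sys I B).u e x = 0 → (sys I B).u e' x = 1 := by
  obtain ⟨-, hW, -, -, -, hL, -, -, hG, -, -, -, -, -, -, hcoef, hT3, -⟩ := id hD
  intro x hxu hue
  have hl : coef I B.C₁ B.G₁ (I.vars e 2) x ≠ 0 := by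
    rw [hcoef, hxu]
    have e2 : ∀ k : ZMod 2, k + (k + 1) ≠ 0 := by decide
    exact e2 κ₀
  have z01 : ∀ t : ZMod 2, t ≠ 0 → t = 1 := by decide
  exact z01 _ (caseT_not_cokillable I hI hT hW hL hG hT3 hmvT he' hne (hP x) (hread x) hl hue)

/-- **Every edge of `D e` off `u` touches `D e'`** (CASE T). -/
theorem caseT_touch (I : LocalMap 4 n m) (hI : I.IsPure xorAndPred) (hT : Typed I) (hS : SimpleOverlap I) {r₀ : ℕ} {B : BridgeData n m}
    {e g₀ : Fin m} {u : Fin n} {κ₀ : ZMod 2} (hD : GateDataX I r₀ B e g₀ u κ₀) {mv : V2} (hmvT : mv = (0, 1) ∨ mv = (1, 1))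
    {e' : Fin m} (he' : e' ∈ B.N) (hne : e' ≠ e)
    (hP : ∀ a, ((sys I B).ρ e' a = 0 ∨ (sys I B).ρ e' a = mv) ∧ ((sys I B).ρ' e' a = 0 ∨ (sys I B).ρ' e' a = mv))
    (hread : ∀ a, (sys I B).ρ e' a ≠ 0 ∨ (sys I B).ρ' e' a ≠ 0)
    {π : Fin m} (hπ : π ∈ B.D e) (h2u : I.vars π 2 ≠ u) (h3u : I.vars π 3 ≠ u)
    (h2 : I.vars π 2 ∉ (B.D e').biUnion (andPair I)) (h3 : I.vars π 3 ∉ (B.D e').biUnion (andPair I)) : False := by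
  obtain ⟨-, hW, -⟩ := id hD
  exact touch_core I hI hS hW he' u (κ₀ + 1) (caseT_force I hI hT hD hmvT he' hne hP hread) hπ h2u h3u h2 h3

/-- **Every edge of `D e'` off `u` touches `D e`** (CASE T). -/
theorem caseT_touch' (I : LocalMap 4 n m) (hI : I.IsPure xorAndPred) (hT : Typed I) (hS : SimpleOverlap I) {r₀ : ℕ} {B : BridgeData n m}
    {e g₀ : Fin m} {u : Fin n} {κ₀ : ZMod 2} (hD : GateDataX I r₀ B e g₀ u κ₀) {mv : V2} (hmvT : mv = (0, 1) ∨ mv = (1, 1))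
    {e' : Fin m} (he' : e' ∈ B.N) (hne : e' ≠ e)
    (hP : ∀ a, ((sys I B).ρ e' a = 0 ∨ (sys I B).ρ e' a = mv) ∧ ((sys I B).ρ' e' a = 0 ∨ (sys I B).ρ' e' a = mv))
    (hread : ∀ a, (sys I B).ρ e' a ≠ 0 ∨ (sys I B).ρ' e' a ≠ 0)
    {π : Fin m} (hπ : π ∈ B.D e') (h2u : I.vars π 2 ≠ u) (h3u : I.vars π 3 ≠ u)
    (h2 : I.vars π 2 ∉ (B.D e).biUnion (andPair I)) (h3 : I.vars π 3 ∉ (B.D e).biUnion (andPair I)) : False := by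
  obtain ⟨-, hW, -, -, -, -, -, -, hG, -⟩ := id hD
  have hforce := caseT_force I hI hT hD hmvT he' hne hP hread
  refine touch_core I hI hS hW hG.1 u (κ₀ + 1) (fun x hx h0 => ?_) hπ h2u h3u h2 h3
  by_contra h1
  have z01 : ∀ t : ZMod 2, t ≠ 1 → t = 0 := by decide
  have h := hforce x hx (z01 _ h1)
  rw [h0] at h
  exact zero_ne_one h

end Summit.PneNP.PneNP.Theorems.PstarGateCaseTTouch
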